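import Summits.AtomisticToContinuum.HydrodynamicLimit.Theorems.ImplosionDichotomyDenseExcursionMemberCoreProfile
import Summits.AtomisticToContinuum.HydrodynamicLimit.Theorems.ImplosionDichotomyDenseExcursionMemberCoreReference
import Summits.AtomisticToContinuum.HydrodynamicLimit.Theorems.ImplosionDichotomyDenseExcursionMemberCoreKidder
import Summits.AtomisticToContinuum.HydrodynamicLimit.Theorems.ImplosionDichotomyDenseExcursionMemberCoreChart

/-!
# Member-core identification: `stub_memberCore` (line `kidder-knob-melnikov`, crux `DenseExcursion`)

Crux `Summit.AtomisticToContinuum.HydrodynamicLimit.Theses.ImplosionDichotomy.DenseExcursion`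
(stmt-AtomisticToContinuum-12586), skeleton `Cruxes/DenseExcursion/Lines/kidder_knob_melnikov.lean`, registered stub
`stub_memberCore : HsEulerConeLocality → ProjectiveCovariance → MemberCore` (statements in `…ConeDefs.lean`).

**Theorem.** Given cone locality for the full athermal Euler system (`HsEulerConeLocality`), every classical
ideal (`σ = 0`) development on `𝕋³` of the data of a knob member `b > bLo` coincides with the member's
reference fields `(ρI b, uI b, θI b)` on the straight acoustic cone `‖y‖ + ct < Rc`, `0 ≤ t < min t₁ T'`, of
the core chart, for a speed `c = c(F, b, t₁)`.

**Proof** (the plan of the skeleton's docstring, assembled from four landed helper files).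
1. *Reference as an explicit global solution.* On the window `{s < T/(1+bT)} ∩ {0 < 1 − bs}` (which contains
   `[0, t₁]`, `kidderFactor_pos`) the Kidder images `kScalar 3 / kVel / kScalar 2` (parameter `b`) of the
   self-similar chart fields `ssScalar T r (−3(1−1/r)) Pf`, `ssVel T r Uf`, `ssScalar T r (2(1/r−1)) Qf` are
   jointly `C^∞` (`contDiffOn_kScalar/kVel`, from `contDiffOn_selfSimilarField`), positive, and solve
   `AthermalEulerAt 1` (`ref_solves` = `memberCore_profileEqs` (`…MemberCoreProfile.lean`: the reduced ODEs of
   `KnobFamily.profileODE` in vector form on `ℝ³`) + `memberCore_selfSimilar_solves` (`…MemberCoreReference.lean`: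
   the ansatz solves the ideal system for `t < T`) + `memberCore_kidder_solves` (`…MemberCoreKidder.lean`: Kidder
   images of solutions are solutions, both signs of `b`, via `dual_mass/momentum/temperature`)). By
   `KnobFamily.kidder` + `selfSimilar` they ARE `(ρI b, uI b, θI b)` on `‖y‖ < Rc(1 − bs)` (`ref_eq`).
2. *Torus solution in the chart* (`memberCore_chart_solves`, `…MemberCoreChart.lean`): `(s, v) ↦ ρ s (x₀ + proj v)`
   etc. are `C^∞` on `[0, T') × ℝ³` and solve `AthermalEulerAt 1` at interior times.
3. *Cone locality* at `ζ ≡ 1`, `J = univ`, on the slab `[0, τ)`, `t < τ < min t₁ T'`: densities of both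
   solutions lie in a compact `[a, b'] ⊂ (0, ∞)` (reference: extreme values on `[0, t₁] × B̄(0, Rc)`,
   `ref_bounds`; torus: `exists_norm_le_of_isCompact` for `ρ` and `ρ⁻¹` on `[0, τ] × 𝕋³`), the characteristic
   speed of the reference on `[0, t₁] × B̄(0, Rc)` is `≤ M`, and `c := max M 0 + Rc·max b 0`, chosen from
   `(F, b, t₁)` alone, also guarantees `‖y‖ + ct < Rc ⇒ ‖y‖ < Rc(1 − bt)`; the data agree on `‖y‖ < Rc` by
   `KnobFamily.data` and `ref_eq` at `s = 0`.
The hypothesis `ProjectiveCovariance` (stated for `0 < a` only) is not needed: step 1 uses the residual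
identities behind it directly, for `a = −1/b` of either sign.
-/

noncomputable section

open Set Filter Topology InnerProductSpace Metric
open scoped ContDiff RealInnerProductSpace

namespace Summit.AtomisticToContinuum.HydrodynamicLimit.Theorems.KidderKnobMelnikov

open Literature.MathematicalPhysics.KineticTheory (T3 V3 IsHardSphereEulerSolution)
open Literature.Analysis.FunctionSpaces (Torus.proj Torus.IsSmoothSpaceTimeOn
  Torus.IsSmoothSpaceTimeOn.exists_norm_le_of_isCompact)

namespace MemberCoreProof

/-! ## The Kidder window of a member -/

section Window

variable (F : KnobFamily) {b : ℝ}

/-- `-1 < bT` for every member `b > bLo` (since `bLo T > -1`). [folklore] -/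
theorem neg_one_lt_mul_T (hb : F.bLo < b) : -1 < b * F.T :=
  F.hbLo.1.trans (mul_lt_mul_of_pos_right hb F.hT)

/-- The Kidder time `T/(1 + bT)` of a member is positive. [folklore] -/
theorem kidderTime_pos (hb : F.bLo < b) : 0 < F.T / (1 + b * F.T) :=
  div_pos F.hT (by linarith [neg_one_lt_mul_T F hb])

/-- **Kidder window.** For `s < T/(1 + bT)` with `0 < 1 − bs`, the rescaled time `s/(1 − bs)` is `< T`.
[folklore] -/
theorem rescaled_lt_T (hb : F.bLo < b) {s : ℝ} (hs : s < F.T / (1 + b * F.T)) (hpos : 0 < 1 - b * s) :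
    (1 - b * s)⁻¹ * s < F.T := by
  have h1 : 0 < 1 + b * F.T := by linarith [neg_one_lt_mul_T F hb]
  have hs' : s * (1 + b * F.T) < F.T := by rwa [lt_div_iff₀ h1] at hs
  rw [inv_mul_lt_iff₀ hpos]
  nlinarith [hs', F.hT]

/-- For `0 ≤ s < T/(1 + bT)` the Kidder factor is positive: `0 < 1 − bs`. [folklore] -/
theorem kidderFactor_pos (hb : F.bLo < b) {s : ℝ} (hs0 : 0 ≤ s) (hs : s < F.T / (1 + b * F.T)) :
    0 < 1 - b * s := by
  have h1 : 0 < 1 + b * F.T := by linarith [neg_one_lt_mul_T F hb]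
  have hs' : s * (1 + b * F.T) < F.T := by rwa [lt_div_iff₀ h1] at hs
  have key : s < F.T * (1 - b * s) := by nlinarith [hs']
  by_contra h
  exact absurd key (not_lt.2 ((mul_nonpos_of_nonneg_of_nonpos F.hT.le (not_lt.1 h)).trans hs0))

/-- The open time domain `{s < T/(1+bT)} ∩ {0 < 1 − bs}` of the member-`b` reference fields. [folklore] -/
theorem isOpen_window (b : ℝ) : IsOpen {s : ℝ | s < F.T / (1 + b * F.T) ∧ 0 < 1 - b * s} :=
  (isOpen_lt continuous_id continuous_const).inter
    (isOpen_lt continuous_const (continuous_const.sub (continuous_const.mul continuous_id)))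

/-- `[0, t₁] ⊆` the window for `t₁ < T/(1+bT)`. [folklore] -/
theorem Icc_subset_window (hb : F.bLo < b) {t₁ : ℝ} (ht₁ : t₁ < F.T / (1 + b * F.T)) :
    Icc 0 t₁ ⊆ {s : ℝ | s < F.T / (1 + b * F.T) ∧ 0 < 1 - b * s} := fun _ hs =>
  ⟨hs.2.trans_lt ht₁, kidderFactor_pos F hb hs.1 (hs.2.trans_lt ht₁)⟩

end Window

/-! ## Smoothness of the reference fields -/

section Smooth

variable {G : Type*} [NormedAddCommGroup G] [NormedSpace ℝ G]

/-- The self-similar scalar chart field `ssScalar` is jointly smooth on `{t < T} × ℝ³`. [folklore] -/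
theorem contDiffOn_ssScalar {S : ℝ → ℝ} (hS : ContDiff ℝ ∞ fun y : V3 => S ‖y‖) (T r p : ℝ) :
    ContDiffOn ℝ ∞ (fun w : ℝ × V3 => ssScalar T r p S w.1 w.2) (Iio T ×ˢ univ) := by
  refine (contDiffOn_selfSimilarField hS T p (-(1 / r))).congr fun w hw => ?_
  have ht : w.1 < T := (mem_prod.1 hw).1
  simp only [ssScalar, smul_eq_mul, norm_rpow_neg_smul ht]

/-- The self-similar velocity chart field `ssVel` is jointly smooth on `{t < T} × ℝ³`. [folklore] -/
theorem contDiffOn_ssVel {U : ℝ → ℝ} (hU : ContDiff ℝ ∞ fun y : V3 => (U ‖y‖ / ‖y‖) • y) (T r : ℝ) :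
    ContDiffOn ℝ ∞ (fun w : ℝ × V3 => ssVel T r U w.1 w.2) (Iio T ×ˢ univ) := by
  refine (contDiffOn_selfSimilarField hU T (1 / r - 1) (-(1 / r))).congr fun w hw => ?_
  exact selfSimilar_velocity_eq U (mem_prod.1 hw).1 r w.2

variable (F : KnobFamily) {b : ℝ}

/-- The Kidder rescaling `(s, y) ↦ (λs, λy)` is smooth on the window and maps it into `{t < T} × ℝ³`.
[folklore] -/
theorem contDiffOn_kidderMap (hb : F.bLo < b) :
    ContDiffOn ℝ ∞ (fun w : ℝ × V3 => (((1 - b * w.1)⁻¹ * w.1, (1 - b * w.1)⁻¹ • w.2) : ℝ × V3))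
        ({s : ℝ | s < F.T / (1 + b * F.T) ∧ 0 < 1 - b * s} ×ˢ univ) ∧
      MapsTo (fun w : ℝ × V3 => (((1 - b * w.1)⁻¹ * w.1, (1 - b * w.1)⁻¹ • w.2) : ℝ × V3))
        ({s : ℝ | s < F.T / (1 + b * F.T) ∧ 0 < 1 - b * s} ×ˢ univ) (Iio F.T ×ˢ univ) := by
  have hlam : ContDiffOn ℝ ∞ (fun w : ℝ × V3 => (1 - b * w.1)⁻¹)
      ({s : ℝ | s < F.T / (1 + b * F.T) ∧ 0 < 1 - b * s} ×ˢ univ) :=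
    (contDiff_const.sub (contDiff_const.mul contDiff_fst)).contDiffOn.inv
      fun w hw => (mem_prod.1 hw).1.2.ne'
  refine ⟨(hlam.mul contDiff_fst.contDiffOn).prodMk (hlam.smul contDiff_snd.contDiffOn), fun w hw => ?_⟩
  obtain ⟨⟨hs, hpos⟩, -⟩ := mem_prod.1 hw
  exact mk_mem_prod (rescaled_lt_T F hb hs hpos) (mem_univ _)

/-- Kidder images `kScalar n` of fields smooth on `{t < T} × ℝ³` are smooth on the window. [folklore] -/
theorem contDiffOn_kScalar (hb : F.bLo < b) {S₀ : ℝ → V3 → ℝ}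
    (hS : ContDiffOn ℝ ∞ (fun w : ℝ × V3 => S₀ w.1 w.2) (Iio F.T ×ˢ univ)) (n : ℕ) :
    ContDiffOn ℝ ∞ (fun w : ℝ × V3 => kScalar n S₀ b w.1 w.2)
      ({s : ℝ | s < F.T / (1 + b * F.T) ∧ 0 < 1 - b * s} ×ˢ univ) := by
  obtain ⟨hm, hmaps⟩ := contDiffOn_kidderMap F hb
  have hlam : ContDiffOn ℝ ∞ (fun w : ℝ × V3 => (1 - b * w.1)⁻¹)
      ({s : ℝ | s < F.T / (1 + b * F.T) ∧ 0 < 1 - b * s} ×ˢ univ) :=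
    (contDiff_const.sub (contDiff_const.mul contDiff_fst)).contDiffOn.inv
      fun w hw => (mem_prod.1 hw).1.2.ne'
  exact (hlam.pow n).mul (hS.comp hm hmaps)

/-- Kidder images `kVel` of velocity fields smooth on `{t < T} × ℝ³` are smooth on the window. [folklore] -/
theorem contDiffOn_kVel (hb : F.bLo < b) {U₀ : ℝ → V3 → V3}
    (hU : ContDiffOn ℝ ∞ (fun w : ℝ × V3 => U₀ w.1 w.2) (Iio F.T ×ˢ univ)) :
    ContDiffOn ℝ ∞ (fun w : ℝ × V3 => kVel U₀ b w.1 w.2)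
      ({s : ℝ | s < F.T / (1 + b * F.T) ∧ 0 < 1 - b * s} ×ˢ univ) := by
  obtain ⟨hm, hmaps⟩ := contDiffOn_kidderMap F hb
  have hlam : ContDiffOn ℝ ∞ (fun w : ℝ × V3 => (1 - b * w.1)⁻¹)
      ({s : ℝ | s < F.T / (1 + b * F.T) ∧ 0 < 1 - b * s} ×ˢ univ) :=
    (contDiff_const.sub (contDiff_const.mul contDiff_fst)).contDiffOn.inv
      fun w hw => (mem_prod.1 hw).1.2.ne'
  exact hlam.smul ((hU.comp hm hmaps).sub (contDiff_snd.const_smul b).contDiffOn)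

end Smooth

/-! ## The reference fields of member `b` on the core are the Kidder images of the self-similar ansatz -/

section RefEq

variable (F : KnobFamily) {b : ℝ}

/-- **The reference fields in closed form.** For `b > bLo`, `0 ≤ s < T/(1+bT)` and `‖y‖ < Rc(1 − bs)`,
`(ρI b, uI b, θI b)` at `(s, x₀ + proj y)` are the Kidder images `kScalar 3 / kVel / kScalar 2` of the
self-similar chart fields `ssScalar T r (−3(1−1/r)) Pf`, `ssVel T r Uf`, `ssScalar T r (2(1/r−1)) Qf`
(fields `kidder` + `selfSimilar` of `KnobFamily`). [folklore] -/
theorem ref_eq (hb : F.bLo < b) {s : ℝ} (hs0 : 0 ≤ s) (hs : s < F.T / (1 + b * F.T)) {y : V3}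
    (hy : ‖y‖ < F.Rc * (1 - b * s)) :
    F.ρI b s (F.x₀ + Torus.proj y) = kScalar 3 (ssScalar F.T F.r (-(3 * (1 - 1 / F.r))) F.Pf) b s y ∧
    F.uI b s (F.x₀ + Torus.proj y) = kVel (ssVel F.T F.r F.Uf) b s y ∧
    F.θI b s (F.x₀ + Torus.proj y) = kScalar 2 (ssScalar F.T F.r (2 * (1 / F.r - 1)) F.Qf) b s y := by
  have hpos : 0 < 1 - b * s := kidderFactor_pos F hb hs0 hs
  have hL0 : 0 < (1 - b * s)⁻¹ := inv_pos.2 hpos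
  have hLs : (1 - b * s)⁻¹ * s < F.T := rescaled_lt_T F hb hs hpos
  have hLy : ‖(1 - b * s)⁻¹ • y‖ < F.Rc := by
    rw [norm_smul, Real.norm_of_nonneg hL0.le]
    calc (1 - b * s)⁻¹ * ‖y‖ < (1 - b * s)⁻¹ * (F.Rc * (1 - b * s)) := mul_lt_mul_of_pos_left hy hL0
      _ = F.Rc := by field_simp
  obtain ⟨k1, k2, k3⟩ := F.kidder b hb s hs0 hs y hy
  obtain ⟨s1, s2, s3⟩ := F.selfSimilar ((1 - b * s)⁻¹ * s) (mul_nonneg hL0.le hs0) hLs _ hLy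
  rw [k1, k2, k3, s1, s2, s3]
  exact ⟨rfl, rfl, rfl⟩

/-- The reference density of member `b` is positive on the window. [folklore] -/
theorem refDensity_pos (hb : F.bLo < b) {s : ℝ} (hs : s < F.T / (1 + b * F.T)) (hpos : 0 < 1 - b * s)
    (y : V3) : 0 < kScalar 3 (ssScalar F.T F.r (-(3 * (1 - 1 / F.r))) F.Pf) b s y := by
  have hLs := rescaled_lt_T F hb hs hpos
  simp only [kScalar, ssScalar]
  exact mul_pos (pow_pos (inv_pos.2 hpos) 3) (mul_pos (Real.rpow_pos_of_pos (sub_pos.2 hLs) _)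
    (F.profilePos _ (div_nonneg (norm_nonneg _) (Real.rpow_nonneg (sub_pos.2 hLs).le _))).1)

/-- The reference temperature of member `b` is positive on the window. [folklore] -/
theorem refTemperature_pos (hb : F.bLo < b) {s : ℝ} (hs : s < F.T / (1 + b * F.T)) (hpos : 0 < 1 - b * s)
    (y : V3) : 0 < kScalar 2 (ssScalar F.T F.r (2 * (1 / F.r - 1)) F.Qf) b s y := by
  have hLs := rescaled_lt_T F hb hs hpos
  simp only [kScalar, ssScalar]
  exact mul_pos (pow_pos (inv_pos.2 hpos) 2) (mul_pos (Real.rpow_pos_of_pos (sub_pos.2 hLs) _)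
    (F.profilePos _ (div_nonneg (norm_nonneg _) (Real.rpow_nonneg (sub_pos.2 hLs).le _))).2)

end RefEq

/-! ## The reference solves the ideal system; compact bounds -/

section Reference

variable (F : KnobFamily) {b : ℝ}

-- (reference fields of member `b` written out in full below: density `kScalar 3 (ssScalar … Pf) b`,
-- temperature `kScalar 2 (ssScalar … Qf) b`, velocity `kVel (ssVel … Uf) b`)

/-- **The reference fields of member `b` solve the ideal system on the window** (profile equations +
self-similar ansatz + Kidder transform). [folklore] -/
theorem ref_solves (hb : F.bLo < b) {s : ℝ} (hs : s < F.T / (1 + b * F.T)) (hpos : 0 < 1 - b * s)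
    (y : V3) : AthermalEulerAt (fun _ => 1) (kScalar 3 (ssScalar F.T F.r (-(3 * (1 - 1 / F.r))) F.Pf) b) (kScalar 2 (ssScalar F.T F.r (2 * (1 / F.r - 1)) F.Qf) b) (kVel (ssVel F.T F.r F.Uf) b) s y := by
  obtain ⟨hPs, hUs, hQs⟩ := F.smoothProfile
  have hE :=
    memberCore_profileEqs F.r F.Pf F.Uf F.Qf hPs hUs hQs (fun ζ hζ => (F.profilePos ζ hζ).1) F.profileODE
  have h0 := memberCore_selfSimilar_solves F.T F.r F.Pf F.Uf F.Qf (hPs.of_le (by simp)) (hUs.of_le (by simp))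
    (hQs.of_le (by simp)) hE
  exact memberCore_kidder_solves F.T b _ _ _ ((contDiffOn_ssScalar hPs _ _ _).of_le (by simp))
    ((contDiffOn_ssScalar hQs _ _ _).of_le (by simp)) ((contDiffOn_ssVel hUs _ _).of_le (by simp)) h0 s y hpos
    (rescaled_lt_T F hb hs hpos)

/-- A continuous real function on a compact set is bounded above. [folklore] -/
theorem exists_upper_bound {X : Type*} [TopologicalSpace X] {K : Set X} (hK : IsCompact K) {f : X → ℝ}
    (hf : ContinuousOn f K) : ∃ C : ℝ, ∀ p ∈ K, f p ≤ C := by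
  obtain ⟨C, hC⟩ := hK.exists_bound_of_continuousOn hf
  exact ⟨C, fun p hp => (le_abs_self _).trans ((Real.norm_eq_abs _).symm.trans_le (hC p hp))⟩

/-- **Compact bounds for the reference on `[0, t₁] × B̄(0, Rc)`**: a positive lower and an upper bound for
the density, and a bound `M` for the characteristic speed `‖u‖ + √(θ(ζ + ρζ′) + (2/3)θζ²)` at `ζ ≡ 1`
(written exactly as `HsEulerConeLocality` reads it). [folklore] -/
theorem ref_bounds (hb : F.bLo < b) {t₁ : ℝ} (ht₁ : t₁ < F.T / (1 + b * F.T)) :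
    ∃ a₁ B₁ M : ℝ, 0 < a₁ ∧ ∀ s ∈ Icc 0 t₁, ∀ y : V3, ‖y‖ ≤ F.Rc →
      a₁ ≤ (kScalar 3 (ssScalar F.T F.r (-(3 * (1 - 1 / F.r))) F.Pf) b) s y ∧ (kScalar 3 (ssScalar F.T F.r (-(3 * (1 - 1 / F.r))) F.Pf) b) s y ≤ B₁ ∧
      ‖(kVel (ssVel F.T F.r F.Uf) b) s y‖ + Real.sqrt ((kScalar 2 (ssScalar F.T F.r (2 * (1 / F.r - 1)) F.Qf) b) s y * (1 + (kScalar 3 (ssScalar F.T F.r (-(3 * (1 - 1 / F.r))) F.Pf) b) s y * deriv (fun _ : ℝ => (1 : ℝ)) ((kScalar 3 (ssScalar F.T F.r (-(3 * (1 - 1 / F.r))) F.Pf) b) s y)) +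
        2 / 3 * (kScalar 2 (ssScalar F.T F.r (2 * (1 / F.r - 1)) F.Qf) b) s y * 1 ^ 2) ≤ M := by
  obtain ⟨hPs, hUs, hQs⟩ := F.smoothProfile
  set K : Set (ℝ × V3) := Icc 0 t₁ ×ˢ closedBall 0 F.Rc with hK_def
  have hK : IsCompact K := isCompact_Icc.prod (isCompact_closedBall 0 F.Rc)
  have hKw : K ⊆ {s : ℝ | s < F.T / (1 + b * F.T) ∧ 0 < 1 - b * s} ×ˢ univ :=
    prod_mono (Icc_subset_window F hb ht₁) (subset_univ _)
  have cP : ContinuousOn (fun w : ℝ × V3 => (kScalar 3 (ssScalar F.T F.r (-(3 * (1 - 1 / F.r))) F.Pf) b) w.1 w.2) K :=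
    ((contDiffOn_kScalar F hb (contDiffOn_ssScalar hPs _ _ _) 3).continuousOn).mono hKw
  have cQ : ContinuousOn (fun w : ℝ × V3 => (kScalar 2 (ssScalar F.T F.r (2 * (1 / F.r - 1)) F.Qf) b) w.1 w.2) K :=
    ((contDiffOn_kScalar F hb (contDiffOn_ssScalar hQs _ _ _) 2).continuousOn).mono hKw
  have cU : ContinuousOn (fun w : ℝ × V3 => (kVel (ssVel F.T F.r F.Uf) b) w.1 w.2) K :=
    ((contDiffOn_kVel F hb (contDiffOn_ssVel hUs _ _)).continuousOn).mono hKw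
  obtain ⟨a₁, ha₁, hlow⟩ := hK.exists_forall_le' cP (a := 0) fun w hw =>
    refDensity_pos F hb (hKw hw).1.1 (hKw hw).1.2 w.2
  obtain ⟨B₁, hB₁⟩ := exists_upper_bound hK cP
  have cS : ContinuousOn (fun w : ℝ × V3 => ‖(kVel (ssVel F.T F.r F.Uf) b) w.1 w.2‖ +
      Real.sqrt ((kScalar 2 (ssScalar F.T F.r (2 * (1 / F.r - 1)) F.Qf) b) w.1 w.2 * (1 + (kScalar 3 (ssScalar F.T F.r (-(3 * (1 - 1 / F.r))) F.Pf) b) w.1 w.2 * deriv (fun _ : ℝ => (1 : ℝ)) ((kScalar 3 (ssScalar F.T F.r (-(3 * (1 - 1 / F.r))) F.Pf) b) w.1 w.2)) +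
        2 / 3 * (kScalar 2 (ssScalar F.T F.r (2 * (1 / F.r - 1)) F.Qf) b) w.1 w.2 * 1 ^ 2)) K := by
    simp only [deriv_const', mul_zero, add_zero, mul_one, one_pow]
    exact cU.norm.add (cQ.add (continuousOn_const.mul cQ)).sqrt
  obtain ⟨M, hM⟩ := exists_upper_bound hK cS
  refine ⟨a₁, B₁, M, ha₁, ?_⟩
  intro s hs y hy
  have hw : (s, y) ∈ K := mk_mem_prod hs (mem_closedBall_zero_iff.2 hy)
  exact ⟨hlow (s, y) hw, hB₁ (s, y) hw, hM (s, y) hw⟩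

end Reference

end MemberCoreProof

open MemberCoreProof in
/-- **Member-core identification from cone locality.** For every knob family `F`, member `b > bLo` and
`t₁ < T/(1+bT)` there is `c ≥ 0` such that every classical ideal torus development of the member's data
coincides with `(ρI b, uI b, θI b)` on the cone `‖y‖ + ct < Rc`, `0 ≤ t < min t₁ T'` (module docstring,
steps 1–3). [folklore] -/
theorem memberCore_of_coneLocality (hcone : HsEulerConeLocality) : MemberCore := by
  intro F b t₁ hb ht₁ ht₁K
  obtain ⟨hPs, hUs, hQs⟩ := F.smoothProfile
  obtain ⟨a₁, B₁, M, ha₁, hK⟩ := ref_bounds F hb ht₁K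
  have hRc : 0 < F.Rc := F.hRc.1
  refine ⟨max M 0 + F.Rc * max b 0, by positivity, ?_⟩
  intro T' ρ θ u hE hρ0 hu0 hθ0 t ht y hy
  have hc0 : 0 ≤ max M 0 + F.Rc * max b 0 := by positivity
  have htt₁ : t < t₁ := lt_of_lt_of_le ht.2 (min_le_left _ _)
  have htK : t < F.T / (1 + b * F.T) := htt₁.trans ht₁K
  have hct : F.Rc * b * t ≤ (max M 0 + F.Rc * max b 0) * t := by
    refine mul_le_mul_of_nonneg_right ?_ ht.1
    have h1 : F.Rc * b ≤ F.Rc * max b 0 := mul_le_mul_of_nonneg_left (le_max_left b 0) hRc.le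
    linarith [le_max_right M 0]
  have hyK : ‖y‖ < F.Rc * (1 - b * t) := by nlinarith [hy, hct]
  -- a slab `[0, τ)` with `t < τ < min t₁ T'`
  obtain ⟨τ, htτ, hτm⟩ := exists_between ht.2
  have hτt₁ : τ < t₁ := lt_of_lt_of_le hτm (min_le_left _ _)
  have hτT' : τ < T' := lt_of_lt_of_le hτm (min_le_right _ _)
  have hwin : Ico 0 τ ⊆ {s : ℝ | s < F.T / (1 + b * F.T) ∧ 0 < 1 - b * s} := fun s hs =>
    Icc_subset_window F hb ht₁K ⟨hs.1, (hs.2.trans hτt₁).le⟩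
  have hsl : Ico 0 τ ×ˢ (univ : Set V3) ⊆ {s : ℝ | s < F.T / (1 + b * F.T) ∧ 0 < 1 - b * s} ×ˢ univ :=
    prod_mono hwin subset_rfl
  have hsl' : Ico 0 τ ×ˢ (univ : Set V3) ⊆ Ico 0 T' ×ˢ univ :=
    prod_mono (Ico_subset_Ico_right hτT'.le) subset_rfl
  -- the torus solution read in the chart; bounds for its density on `[0, τ] × 𝕋³`
  obtain ⟨⟨cρ, cθ, cu⟩, cE⟩ := memberCore_chart_solves T' ρ θ u F.x₀ hE
  obtain ⟨B₂, hB₂⟩ := Torus.IsSmoothSpaceTimeOn.exists_norm_le_of_isCompact hE.smooth_density isCompact_Icc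
    (Icc_subset_Ico_right hτT')
  have hinv : Torus.IsSmoothSpaceTimeOn (Ico 0 T') (fun s x => (ρ s x)⁻¹) :=
    ContDiffOn.inv hE.smooth_density fun p hp => (hE.density_pos _ (mem_prod.1 hp).1 _).ne'
  obtain ⟨C₂, hC₂⟩ := Torus.IsSmoothSpaceTimeOn.exists_norm_le_of_isCompact hinv isCompact_Icc
    (Icc_subset_Ico_right hτT')
  have hC₂1 : 0 < max C₂ 1 := by positivity
  have hxR : ∀ {s : ℝ} {x : V3}, 0 ≤ s → ‖x - 0‖ + (max M 0 + F.Rc * max b 0) * s < F.Rc →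
      ‖x‖ ≤ F.Rc := by
    intro s x hs hx
    rw [sub_zero] at hx
    nlinarith [mul_nonneg hc0 hs]
  -- cone locality at `ζ ≡ 1` on the slab `[0, τ) × ℝ³`, ball `‖x‖ < Rc`
  have key := hcone (fun _ => 1) univ (min a₁ (max C₂ 1)⁻¹) (max B₁ B₂) isOpen_univ contDiffOn_const
    (subset_univ _) (lt_min ha₁ (inv_pos.2 hC₂1)) (fun r _ => by simp)
    (kScalar 3 (ssScalar F.T F.r (-(3 * (1 - 1 / F.r))) F.Pf) b)
    (kScalar 2 (ssScalar F.T F.r (2 * (1 / F.r - 1)) F.Qf) b)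
    (fun s v => ρ s (F.x₀ + Torus.proj v)) (fun s v => θ s (F.x₀ + Torus.proj v))
    (kVel (ssVel F.T F.r F.Uf) b) (fun s v => u s (F.x₀ + Torus.proj v)) 0 F.Rc (max M 0 + F.Rc * max b 0) τ
    (((contDiffOn_kScalar F hb (contDiffOn_ssScalar hPs _ _ _) 3).of_le (by simp)).mono hsl)
    (((contDiffOn_kScalar F hb (contDiffOn_ssScalar hQs _ _ _) 2).of_le (by simp)).mono hsl)
    (((contDiffOn_kVel F hb (contDiffOn_ssVel hUs _ _)).of_le (by simp)).mono hsl)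
    ((cρ.of_le (by simp)).mono hsl') ((cθ.of_le (by simp)).mono hsl') ((cu.of_le (by simp)).mono hsl')
    ?_ ?_ hc0 ?_ ?_ t ⟨ht.1, htτ⟩ y (by simpa only [sub_zero] using hy)
  · -- conclusion: torus solution = reference = `(ρI b, uI b, θI b)` at `(t, x₀ + proj y)`
    obtain ⟨e1, e2, e3⟩ := key
    obtain ⟨r1, r2, r3⟩ := ref_eq F hb ht.1 htK hyK
    exact ⟨by rw [r1, e1], by rw [r2, e2], by rw [r3, e3]⟩
  · -- ranges: densities in `[a, b']`, temperatures positive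
    intro s hs x hx
    have hx' := hxR hs.1 hx
    have hsI : s ∈ Icc 0 t₁ := ⟨hs.1, (hs.2.trans hτt₁).le⟩
    have hsτ : s ∈ Icc 0 τ := ⟨hs.1, hs.2.le⟩
    have hsT : s ∈ Ico 0 T' := ⟨hs.1, hs.2.trans hτT'⟩
    obtain ⟨q1, q2, -⟩ := hK s hsI x hx'
    have hρp : 0 < ρ s (F.x₀ + Torus.proj x) := hE.density_pos s hsT _
    have hlo : (max C₂ 1)⁻¹ ≤ ρ s (F.x₀ + Torus.proj x) := by
      refine inv_le_of_inv_le₀ hρp ((le_abs_self _).trans ?_)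
      exact ((Real.norm_eq_abs _).symm.trans_le (hC₂ s hsτ _)).trans (le_max_left _ _)
    have hhi : ρ s (F.x₀ + Torus.proj x) ≤ B₂ :=
      (le_abs_self _).trans ((Real.norm_eq_abs _).symm.trans_le (hB₂ s hsτ _))
    exact ⟨⟨(min_le_left _ _).trans q1, q2.trans (le_max_left _ _)⟩,
      ⟨(min_le_right _ _).trans hlo, hhi.trans (le_max_right _ _)⟩,
      refTemperature_pos F hb (hwin hs).1 (hwin hs).2 x, hE.temperature_pos s hsT _⟩
  · -- both triples solve the ideal system at interior times
    intro s hs x _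
    exact ⟨ref_solves F hb (hwin ⟨hs.1.le, hs.2⟩).1 (hwin ⟨hs.1.le, hs.2⟩).2 x,
      cE s ⟨hs.1, hs.2.trans hτT'⟩ x⟩
  · -- characteristic speed of the reference on the cone
    intro s hs x hx
    have h := (hK s ⟨hs.1.le, (hs.2.trans hτt₁).le⟩ x (hxR hs.1.le hx)).2.2
    exact h.trans ((le_max_left M 0).trans (le_add_of_nonneg_right (by positivity)))
  · -- equal data on the ball `‖x‖ < Rc`
    intro x hx
    rw [sub_zero] at hx
    obtain ⟨d1, d2, d3⟩ := F.data b hb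
    obtain ⟨r1, r2, r3⟩ := ref_eq F hb le_rfl (kidderTime_pos F hb) (y := x) (by simpa using hx)
    exact ⟨by rw [← r1, d1, hρ0], by rw [← r2, d2, hu0], by rw [← r3, d3, hθ0]⟩

/-- **STUB `stub_memberCore` of the line `kidder-knob-melnikov`** (crux `ImplosionDichotomy.DenseExcursion`,
stmt-AtomisticToContinuum-12586): the member-core identification `MemberCore` from cone locality
`HsEulerConeLocality` (and, nominally, `ProjectiveCovariance`, whose residual identities are used directly
for both signs of the knob): on the straight acoustic cone of the core chart every classical ideal development
of a knob member's data IS the Kidder image of the exact self-similar core, i.e. the member's reference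
fields. [folklore] -/
theorem stub_memberCore : HsEulerConeLocality → ProjectiveCovariance → MemberCore :=
  fun hcone _ => memberCore_of_coneLocality hcone

end Summit.AtomisticToContinuum.HydrodynamicLimit.Theorems.KidderKnobMelnikov

end
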